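import Mathlib
import Literature.NumberTheory.Transcendental.LinEDS
import HarnessLib

/-!
# `KernelModuloPeriodConjecture`, line `Sketch`, E7: pivots ⇒ odd determinant ⇒ solvable over `ℚ`

Crux `FurushoPentagon.KernelModuloPeriodConjecture` (stmt-KontsevichZagierPeriods-15058), line
`Sketch`; soundness chain of the kernel-checkable `𝔽₂` rank engine `LinEDS` for the linearised
extended double shuffle system [IharaKanekoZagier2006, §2], link E7 (pure linear algebra,
`stub_oddDet_and_solve`):

* (a) given `n` rows (bitsets `row i : ℕ`), `n` strictly increasing column positions `col j`, and
  for every column an XOR-combination `p_j` of the rows (`LinEDS.XorGen`) that is a pivot at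
  `col j` (`LinEDS.isPivotAt`: bit `col j` set, no lower bit), ANY integer matrix `A` whose
  parities are the row bits (`Odd (A i j) ↔ bit (col j) of row i`) has odd determinant. Proof over
  the field `ZMod 2`: the reduction `V` of `A` is the bit matrix; an XOR-combination is an
  `𝔽₂`-linear combination (`Nat.testBit_xor`), so the pivots give a matrix `E` with
  `E * V = T`, `T j j' = bit (col j') of p_j`, which is upper unitriangular (`col` strictly
  increasing), hence `det E * det V = det T = 1` (`Matrix.det_of_upperTriangular`,
  `Matrix.det_mul`) and `det V = 1`, i.e. `det A` is odd (`Int.cast_det`,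
  `ZMod.intCast_eq_one_iff_odd`).
* (b) an integer matrix with odd (hence nonzero) determinant is invertible over `ℚ`
  (`Matrix.nonsing_inv_mul`), so every standard basis row vector is a rational combination of
  its rows.

Everything here is elementary linear algebra over `𝔽₂` and `ℚ`. [folklore]
-/

namespace Summit.KontsevichZagierPeriods.FurushoPentagon.KernelModuloPeriodConjecture

open Literature.NumberTheory.Transcendental

/-- The indicator of an exclusive or in `ZMod 2` is the sum of the indicators. [folklore] -/
theorem oddDetE7_ite_xor (x y : Bool) :
    (if (x ^^ y) then (1 : ZMod 2) else 0) =
      (if x then (1 : ZMod 2) else 0) + (if y then 1 else 0) := by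
  cases x <;> cases y <;> decide

/-- In `ZMod 2`, a right factor of `1` is `1`. [folklore] -/
theorem oddDetE7_zmod_two_mul_eq_one : ∀ x y : ZMod 2, x * y = 1 → y = 1 := by
  decide

/-- `LinEDS.isPivotAt p c` unfolded on bits: bit `c` of `p` is set and no lower bit is.
[folklore] -/
theorem oddDetE7_isPivotAt {p c : ℕ} (h : LinEDS.isPivotAt p c = true) :
    p.testBit c = true ∧ ∀ m < c, p.testBit m = false := by
  have h' : p % 2 ^ (c + 1) = 2 ^ c := by simpa [LinEDS.isPivotAt] using h
  refine ⟨?_, fun m hm => ?_⟩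
  · have := congrArg (·.testBit c) h'
    simpa [Nat.testBit_mod_two_pow, Nat.testBit_two_pow] using this
  · have hc := congrArg (·.testBit m) h'
    have hm' : m < c + 1 := Nat.lt_succ_of_lt hm
    simpa [Nat.testBit_mod_two_pow, Nat.testBit_two_pow, hm', hm.ne'] using hc

/-- An XOR-combination of the rows `row i` is an `𝔽₂`-linear combination bit by bit: there are
coefficients `e i ∈ ZMod 2` with `bit m of p = Σ_i e_i · (bit m of row i)` for every `m`.
[folklore] -/
theorem oddDetE7_xorGen_coeffs {n : ℕ} (row : Fin n → ℕ) {p : ℕ}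
    (hp : LinEDS.XorGen (List.ofFn row) p) :
    ∃ e : Fin n → ZMod 2, ∀ m,
      (if p.testBit m then (1 : ZMod 2) else 0) =
        ∑ i, e i * (if (row i).testBit m then (1 : ZMod 2) else 0) := by
  induction hp with
  | zero => exact ⟨0, fun m => by simp⟩
  | @xor a r _ hr ih =>
    obtain ⟨e, he⟩ := ih
    obtain ⟨i₀, rfl⟩ := List.mem_ofFn.1 hr
    refine ⟨fun i => e i + if i = i₀ then 1 else 0, fun m => ?_⟩
    rw [Nat.testBit_xor, oddDetE7_ite_xor, he m]
    simp only [add_mul, Finset.sum_add_distrib, ite_mul, one_mul, zero_mul, Finset.sum_ite_eq',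
      Finset.mem_univ, if_true]

/-- **(a) over `𝔽₂`.** With a pivoting XOR-combination of the rows at every one of `n` strictly
increasing columns, the `n × n` bit matrix `(bit (col j) of row i)` over `ZMod 2` has determinant
`1`: the coefficient matrix `E` of the pivots satisfies `E * V = T` with `T` upper unitriangular.
[folklore] -/
theorem oddDetE7_det_bits_eq_one {n : ℕ} {row col : Fin n → ℕ} (hcol : StrictMono col)
    (hpiv : ∀ j, ∃ p, LinEDS.XorGen (List.ofFn row) p ∧ LinEDS.isPivotAt p (col j) = true) :
    (Matrix.of fun i j => if (row i).testBit (col j) then (1 : ZMod 2) else 0).det = 1 := by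
  choose p hp using hpiv
  choose e he using fun j => oddDetE7_xorGen_coeffs row (hp j).1
  have hEV : Matrix.of e *
      Matrix.of (fun i j => if (row i).testBit (col j) then (1 : ZMod 2) else 0) =
        Matrix.of fun j j' => if (p j).testBit (col j') then (1 : ZMod 2) else 0 := by
    ext j j'
    rw [Matrix.mul_apply, Matrix.of_apply, he j (col j')]
    simp only [Matrix.of_apply]
  have hT : (Matrix.of fun j j' => if (p j).testBit (col j') then (1 : ZMod 2) else 0).det = 1 := by
    rw [Matrix.det_of_upperTriangular, Finset.prod_eq_one]
    · intro j _
      rw [Matrix.of_apply, (oddDetE7_isPivotAt (hp j).2).1, if_pos rfl]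
    · intro j j' hjj'
      rw [Matrix.of_apply, (oddDetE7_isPivotAt (hp j).2).2 (col j') (hcol hjj')]
      exact if_neg Bool.false_ne_true
  have hdet := congrArg Matrix.det hEV
  rw [Matrix.det_mul, hT] at hdet
  exact oddDetE7_zmod_two_mul_eq_one _ _ hdet

/-- **(b).** An integer square matrix with odd determinant is invertible over `ℚ`; row `j₀` of the
inverse expresses the `j₀`-th standard basis row vector as a rational combination of the rows.
[folklore] -/
theorem oddDetE7_solve {n : ℕ} (A : Matrix (Fin n) (Fin n) ℤ) (hA : Odd A.det) (j₀ : Fin n) :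
    ∃ l : Fin n → ℚ, ∀ j, ∑ i, l i * (A i j : ℚ) = if j = j₀ then 1 else 0 := by
  have hdet : IsUnit (A.map fun x : ℤ => (x : ℚ)).det := by
    rw [isUnit_iff_ne_zero, ← Int.cast_det, Int.cast_ne_zero]
    intro h0
    rw [h0] at hA
    exact absurd (Int.odd_iff.1 hA) (by decide)
  refine ⟨(A.map fun x : ℤ => (x : ℚ))⁻¹ j₀, fun j => ?_⟩
  have h := congrFun (congrFun (Matrix.nonsing_inv_mul _ hdet) j₀) j
  rw [Matrix.mul_apply, Matrix.one_apply] at h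
  simp only [Matrix.map_apply] at h
  rw [h]
  exact if_congr eq_comm rfl rfl

/-- **E7 — pivots in every column force an odd determinant, which solves every column over `ℚ`.**
(a) For `n` rows and `n` strictly increasing columns, XOR-combinations pivoting at every column make
the `𝔽₂`-matrix of bits unitriangular up to an invertible factor, so any integer matrix with these
parities has odd determinant; (b) an integer matrix with odd determinant is invertible over `ℚ`:
every standard basis row vector is a rational combination of its rows. [folklore] -/
theorem stub_oddDet_and_solve :
    (∀ (n : ℕ) (row col : Fin n → ℕ), StrictMono col →
      (∀ j, ∃ p, LinEDS.XorGen (List.ofFn row) p ∧ LinEDS.isPivotAt p (col j) = true) →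
        ∀ A : Matrix (Fin n) (Fin n) ℤ, (∀ i j, Odd (A i j) ↔ (row i).testBit (col j) = true) →
          Odd A.det) ∧
    (∀ (n : ℕ) (A : Matrix (Fin n) (Fin n) ℤ), Odd A.det → ∀ j₀ : Fin n, ∃ l : Fin n → ℚ,
      ∀ j, ∑ i, l i * (A i j : ℚ) = if j = j₀ then 1 else 0) := by
  refine ⟨fun n row col hcol hpiv A hA => ?_, fun n A hA j₀ => oddDetE7_solve A hA j₀⟩
  have hmap : (A.map fun x : ℤ => (x : ZMod 2)) =
      Matrix.of fun i j => if (row i).testBit (col j) then (1 : ZMod 2) else 0 := by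
    ext i j
    rw [Matrix.map_apply, Matrix.of_apply]
    by_cases h : (row i).testBit (col j) = true
    · rw [if_pos h]
      exact ZMod.intCast_eq_one_iff_odd.2 ((hA i j).2 h)
    · rw [if_neg h]
      exact ZMod.intCast_eq_zero_iff_even.2 (Int.not_odd_iff_even.1 fun ho => h ((hA i j).1 ho))
  rw [← ZMod.intCast_eq_one_iff_odd, Int.cast_det, hmap]
  exact oddDetE7_det_bits_eq_one hcol hpiv

end Summit.KontsevichZagierPeriods.FurushoPentagon.KernelModuloPeriodConjecture
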